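import Literature.MathematicalPhysics.QuantumManyBody.SmearedYukawaFourier
import Literature.MathematicalPhysics.QuantumManyBody.CLYFourierPositivity
import Mathlib.Analysis.SpecialFunctions.ImproperIntegrals
import Mathlib.MeasureTheory.Constructions.HaarToSphere
import HarnessLib

/-!
# The Conlon–Lieb–Yau kernel `Y_ν - h·Y_ω` and its (nonnegative, integrable) Fourier transform

Topic `Literature/MathematicalPhysics/QuantumManyBody` (electrostatics groundwork for the charged
Bose gas, `JelliumBoseGas.foldyLaw`; step (iii-a) towards [ConlonLiebYau1988, Lemma 2.1] and the
unconditional sliding lemma [LiebSolovej2001, Lemma 3.1]). For a cutoff `h : ℝ³ → ℝ` —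
continuous, integrable, even, `h(0) = 1`, with `𝓕h ∈ L¹` carrying the moment `(1+|q|²)⁴` — and
`Y_a(x) = e^{-√a|x|}/|x|`, the kernel `K_n = Y_n - h·Y_m` (`0 < n`, `m = ω²`, `n = ν²`) satisfies:

* `𝓕K_n(p) = Φ_n(p) := 4π/(4π²|p|²+n) - ∫ Re𝓕h(q) 4π/(4π²|p-q|²+m) dq` (real),
  by `Coulomb.fourierIntegral_yukawa'` and `Coulomb.fourier_smearedYukawa_re`;
* `Φ_n ≥ 0` when `m ≥ 4π²`, `m - n ≥ 32π²A`, `16π²B` (`Coulomb.cly_fourier_positivity`);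
* `|Φ_n(p)| ≤ (4π/(4π²|p|²+n) - 4π/(4π²|p|²+m)) + 16π³(4A/C² + B/(C m (1+|p|²)²))`, an
  integrable majorant (`Coulomb.cly_taylor_decomposition` and radial integrability lemmas);
* hence `K_n(z) = ∫ Φ_n(p) cos(2π⟨p, z⟩) dp` for `z ≠ 0`
  (`Coulomb.eq_integral_re_fourier_mul_cos_of_continuousAt`).

## References

* [ConlonLiebYau1988] J. G. Conlon, E. H. Lieb, H.-T. Yau, Commun. Math. Phys. 116 (1988) 417–448,
  Lemma 2.1.
* [LiebSolovej2001] E. H. Lieb, J. P. Solovej, Commun. Math. Phys. 217 (2001) 127–163, §3.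
-/

noncomputable section

open MeasureTheory Set Filter Real
open scoped ENNReal NNReal Topology FourierTransform InnerProductSpace

namespace Literature.MathematicalPhysics.QuantumManyBody.Coulomb

open BoseGas Literature.Analysis.UnboundedOperators

/-! ### Radial integrability lemmas on `ℝ³` -/

/-- `p ↦ 1/(b|p|² + a)²` is integrable on `ℝ³` for `a, b > 0` (radially `r²/(br²+a)² ≤ 1/a²` on
`(0,1]` and `≤ 1/(b²r²)` beyond). [folklore] -/
theorem integrable_inv_quadratic_sq {a b : ℝ} (ha : 0 < a) (hb : 0 < b) :
    Integrable fun p : Space => 1 / (b * ‖p‖ ^ 2 + a) ^ 2 := by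
  have h := (integrable_fun_norm_addHaar (volume : Measure Space)
    (f := fun r : ℝ => 1 / (b * r ^ 2 + a) ^ 2)).2
  refine h ?_
  rw [finrank_euclideanSpace_fin, show (3 : ℕ) - 1 = 2 from rfl]
  have hFm : Measurable (fun r : ℝ => r ^ 2 • (1 / (b * r ^ 2 + a) ^ 2)) :=
    (measurable_id.pow_const _).smul (measurable_const.div
      (((measurable_const.mul (measurable_id.pow_const _)).add_const _).pow_const _))
  have hnn : ∀ r : ℝ, 0 ≤ r ^ 2 • (1 / (b * r ^ 2 + a) ^ 2) := fun r => by
    rw [smul_eq_mul]; positivity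
  have h1 : IntegrableOn (fun r : ℝ => r ^ 2 • (1 / (b * r ^ 2 + a) ^ 2)) (Ioc 0 1) := by
    refine Integrable.mono' (g := fun _ => 1 / a ^ 2) (integrableOn_const measure_Ioc_lt_top.ne)
      hFm.aestronglyMeasurable ?_
    refine (ae_restrict_iff' measurableSet_Ioc).2 (Eventually.of_forall fun r hr => ?_)
    rw [Real.norm_of_nonneg (hnn r), smul_eq_mul]
    have hr1 : r ^ 2 ≤ 1 := by nlinarith [hr.1, hr.2]
    have hden : a ^ 2 ≤ (b * r ^ 2 + a) ^ 2 :=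
      pow_le_pow_left₀ ha.le (by nlinarith [sq_nonneg r]) 2
    calc r ^ 2 * (1 / (b * r ^ 2 + a) ^ 2) ≤ 1 * (1 / a ^ 2) := by
          apply mul_le_mul hr1 (one_div_le_one_div_of_le (by positivity) hden) (by positivity)
            zero_le_one
      _ = 1 / a ^ 2 := one_mul _
  have h2 : IntegrableOn (fun r : ℝ => r ^ 2 • (1 / (b * r ^ 2 + a) ^ 2)) (Ioi 1) := by
    have hint : IntegrableOn (fun r : ℝ => (1 / b ^ 2) * r ^ (-2 : ℝ)) (Ioi 1) :=
      ((integrableOn_Ioi_rpow_of_lt (by norm_num : (-2 : ℝ) < -1) zero_lt_one).const_mul _)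
    refine Integrable.mono' hint hFm.aestronglyMeasurable ?_
    refine (ae_restrict_iff' measurableSet_Ioi).2 (Eventually.of_forall fun r hr => ?_)
    have hr1 : (1 : ℝ) < r := hr
    have hr0 : 0 < r := zero_lt_one.trans hr1
    rw [Real.norm_of_nonneg (hnn r), smul_eq_mul]
    have e2 : r ^ (-2 : ℝ) = (r ^ 2)⁻¹ := by
      rw [Real.rpow_neg hr0.le, show (2 : ℝ) = ((2 : ℕ) : ℝ) by norm_num, Real.rpow_natCast]
    rw [e2]
    have hden : (b * r ^ 2) ^ 2 ≤ (b * r ^ 2 + a) ^ 2 :=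
      pow_le_pow_left₀ (by positivity) (by linarith) 2
    calc r ^ 2 * (1 / (b * r ^ 2 + a) ^ 2) ≤ r ^ 2 * (1 / (b * r ^ 2) ^ 2) :=
          mul_le_mul_of_nonneg_left (one_div_le_one_div_of_le (by positivity) hden) (by positivity)
      _ = 1 / b ^ 2 * (r ^ 2)⁻¹ := by field_simp
  have h12 := h1.union h2
  rw [Ioc_union_Ioi_eq_Ioi zero_le_one] at h12
  exact h12

/-- `p ↦ 1/(|p|²(b|p|² + a))` is integrable on `ℝ³` for `a, b > 0` (radially `1/(br²+a)`).
[folklore] -/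
theorem integrable_inv_normSq_mul_quadratic {a b : ℝ} (ha : 0 < a) (hb : 0 < b) :
    Integrable fun p : Space => 1 / (‖p‖ ^ 2 * (b * ‖p‖ ^ 2 + a)) := by
  have h := (integrable_fun_norm_addHaar (volume : Measure Space)
    (f := fun r : ℝ => 1 / (r ^ 2 * (b * r ^ 2 + a)))).2
  refine h ?_
  rw [finrank_euclideanSpace_fin, show (3 : ℕ) - 1 = 2 from rfl]
  have hFm : Measurable (fun r : ℝ => r ^ 2 • (1 / (r ^ 2 * (b * r ^ 2 + a)))) :=
    (measurable_id.pow_const _).smul (measurable_const.div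
      ((measurable_id.pow_const _).mul ((measurable_const.mul (measurable_id.pow_const _)).add_const _)))
  have heq : ∀ r : ℝ, 0 < r → r ^ 2 • (1 / (r ^ 2 * (b * r ^ 2 + a))) = 1 / (b * r ^ 2 + a) := by
    intro r hr
    rw [smul_eq_mul]
    field_simp
  have h1 : IntegrableOn (fun r : ℝ => r ^ 2 • (1 / (r ^ 2 * (b * r ^ 2 + a)))) (Ioc 0 1) := by
    refine Integrable.mono' (g := fun _ => 1 / a) (integrableOn_const measure_Ioc_lt_top.ne)
      hFm.aestronglyMeasurable ?_
    refine (ae_restrict_iff' measurableSet_Ioc).2 (Eventually.of_forall fun r hr => ?_)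
    rw [heq r hr.1, Real.norm_of_nonneg (by positivity)]
    exact one_div_le_one_div_of_le ha (by nlinarith [sq_nonneg r])
  have h2 : IntegrableOn (fun r : ℝ => r ^ 2 • (1 / (r ^ 2 * (b * r ^ 2 + a)))) (Ioi 1) := by
    have hint : IntegrableOn (fun r : ℝ => (1 / b) * r ^ (-2 : ℝ)) (Ioi 1) :=
      ((integrableOn_Ioi_rpow_of_lt (by norm_num : (-2 : ℝ) < -1) zero_lt_one).const_mul _)
    refine Integrable.mono' hint hFm.aestronglyMeasurable ?_
    refine (ae_restrict_iff' measurableSet_Ioi).2 (Eventually.of_forall fun r hr => ?_)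
    have hr1 : (1 : ℝ) < r := hr
    have hr0 : 0 < r := zero_lt_one.trans hr1
    rw [heq r hr0, Real.norm_of_nonneg (by positivity)]
    have e2 : r ^ (-2 : ℝ) = (r ^ 2)⁻¹ := by
      rw [Real.rpow_neg hr0.le, show (2 : ℝ) = ((2 : ℕ) : ℝ) by norm_num, Real.rpow_natCast]
    rw [e2]
    calc 1 / (b * r ^ 2 + a) ≤ 1 / (b * r ^ 2) :=
          one_div_le_one_div_of_le (by positivity) (by linarith)
      _ = 1 / b * (r ^ 2)⁻¹ := by field_simp
  have h12 := h1.union h2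
  rw [Ioc_union_Ioi_eq_Ioi zero_le_one] at h12
  exact h12

/-- **The difference of two Yukawa symbols is integrable**: for `0 ≤ n ≤ m`, `0 < m`,
`p ↦ 4π/(4π²|p|²+n) - 4π/(4π²|p|²+m)` is nonnegative, `≤ (m-n)/(π|p|²(4π²|p|²+m))`, and
integrable on `ℝ³`. [folklore] -/
theorem integrable_yukawaSymbol_sub {m n : ℝ} (hn : 0 ≤ n) (hnm : n ≤ m) (hm : 0 < m) :
    Integrable fun p : Space =>
      4 * π / (4 * π ^ 2 * ‖p‖ ^ 2 + n) - 4 * π / (4 * π ^ 2 * ‖p‖ ^ 2 + m) := by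
  have hπ : 0 < π := Real.pi_pos
  have hmeas : Measurable fun p : Space =>
      4 * π / (4 * π ^ 2 * ‖p‖ ^ 2 + n) - 4 * π / (4 * π ^ 2 * ‖p‖ ^ 2 + m) :=
    (measurable_const.div ((measurable_const.mul (measurable_norm.pow_const _)).add_const _)).sub
      (measurable_const.div ((measurable_const.mul (measurable_norm.pow_const _)).add_const _))
  have hae : ∀ᵐ p : Space ∂volume, p ≠ 0 := by
    have : (volume : Measure Space) {p | ¬p ≠ 0} = 0 := by
      simp only [ne_eq, not_not, setOf_eq_eq_singleton, measure_singleton]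
    exact ae_iff.2 this
  refine ((integrable_inv_normSq_mul_quadratic hm (by positivity : (0:ℝ) < 4 * π ^ 2)).const_mul
    ((m - n) / π)).mono' hmeas.aestronglyMeasurable ?_
  filter_upwards [hae] with p hp
  have hp2 : 0 < ‖p‖ ^ 2 := by positivity
  have hCn : 0 < 4 * π ^ 2 * ‖p‖ ^ 2 + n := by positivity
  have hCm : 0 < 4 * π ^ 2 * ‖p‖ ^ 2 + m := by positivity
  have hsub : 0 ≤ 4 * π / (4 * π ^ 2 * ‖p‖ ^ 2 + n) - 4 * π / (4 * π ^ 2 * ‖p‖ ^ 2 + m) :=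
    sub_nonneg.2 (div_le_div_of_nonneg_left (by positivity) hCn (by linarith))
  rw [Real.norm_eq_abs, abs_of_nonneg hsub]
  have e : 4 * π / (4 * π ^ 2 * ‖p‖ ^ 2 + n) - 4 * π / (4 * π ^ 2 * ‖p‖ ^ 2 + m) =
      4 * π * (m - n) / ((4 * π ^ 2 * ‖p‖ ^ 2 + n) * (4 * π ^ 2 * ‖p‖ ^ 2 + m)) := by
    field_simp
    ring
  rw [e, show (m - n) / π * (1 / (‖p‖ ^ 2 * (4 * π ^ 2 * ‖p‖ ^ 2 + m))) =
    (m - n) / (π * (‖p‖ ^ 2 * (4 * π ^ 2 * ‖p‖ ^ 2 + m))) by field_simp,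
    div_le_div_iff₀ (by positivity) (by positivity)]
  have hmn : 0 ≤ m - n := sub_nonneg.2 hnm
  have hkey : 4 * π * (π * ‖p‖ ^ 2) ≤ 4 * π ^ 2 * ‖p‖ ^ 2 + n := by nlinarith
  calc 4 * π * (m - n) * (π * (‖p‖ ^ 2 * (4 * π ^ 2 * ‖p‖ ^ 2 + m)))
      = (4 * π * (π * ‖p‖ ^ 2)) * ((m - n) * (4 * π ^ 2 * ‖p‖ ^ 2 + m)) := by ring
    _ ≤ (4 * π ^ 2 * ‖p‖ ^ 2 + n) * ((m - n) * (4 * π ^ 2 * ‖p‖ ^ 2 + m)) :=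
        mul_le_mul_of_nonneg_right hkey (by positivity)
    _ = (m - n) * ((4 * π ^ 2 * ‖p‖ ^ 2 + n) * (4 * π ^ 2 * ‖p‖ ^ 2 + m)) := by ring

/-- `(1+|p|²)⁻²` is integrable on `ℝ³`. [folklore] -/
theorem integrable_inv_one_add_normSq_sq : Integrable fun p : Space => 1 / (1 + ‖p‖ ^ 2) ^ 2 := by
  have h := integrable_inv_quadratic_sq (a := 1) (b := 1) one_pos one_pos
  refine h.congr (Eventually.of_forall fun p => ?_)
  simp only [one_mul, add_comm]

/-! ### The smeared cutoff in Fourier space: `η = Re 𝓕h` -/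

/-- For a real `f`, `Re 𝓕f(-q) = Re 𝓕f(q)` (`𝓕f(-q) = conj 𝓕f(q)`). [folklore] -/
theorem re_fourier_ofReal_neg (f : Space → ℝ) (q : Space) :
    (𝓕 (fun x : Space => (f x : ℂ)) (-q)).re = (𝓕 (fun x : Space => (f x : ℂ)) q).re := by
  rw [← Real.fourierInv_eq_fourier_neg, ← conj_fourier_ofReal, Complex.conj_re]

/-- `Re 𝓕h` is continuous for `h ∈ L¹`. [folklore] -/
theorem continuous_re_fourier_ofReal {h : Space → ℝ} (hhi : Integrable h) :
    Continuous fun q : Space => (𝓕 (fun x : Space => (h x : ℂ)) q).re :=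
  Complex.continuous_re.comp (VectorFourier.fourierIntegral_continuous Real.continuous_fourierChar
    (innerSL ℝ).continuous₂ (hhi.ofReal : Integrable (fun x : Space => (h x : ℂ))))

/-- `∫ Re 𝓕h = h(0) = 1` for an even continuous integrable `h` with `𝓕h ∈ L¹` and `h(0) = 1`.
[folklore] -/
theorem integral_re_fourier_eq_one {h : Space → ℝ} (hhc : Continuous h) (hhi : Integrable h)
    (hH : Integrable (𝓕 (fun x : Space => (h x : ℂ)))) (heven : ∀ x, h (-x) = h x)
    (hh0 : h 0 = 1) : ∫ q, (𝓕 (fun x : Space => (h x : ℂ)) q).re = 1 := by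
  rw [← apply_zero_eq_integral_re_fourier hhc hhi hH heven, hh0]

/-! ### The kernel `K_n = Y_n - h Y_m` and its Fourier transform -/

/-- **The CLY kernel is integrable**: `Y_n - h·Y_m ∈ L¹(ℝ³)` for `n, m > 0`. [folklore] -/
theorem integrable_clyKernel {h : Space → ℝ} (hhc : Continuous h) (hhi : Integrable h)
    (hH : Integrable (𝓕 (fun x : Space => (h x : ℂ)))) {m n : ℝ} (hm : 0 < m) (hn : 0 < n) :
    Integrable fun x : Space => Real.exp (-(Real.sqrt n * ‖x‖)) / ‖x‖ -
      h x * (Real.exp (-(Real.sqrt m * ‖x‖)) / ‖x‖) :=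
  (integrable_yukawa hn).sub (integrable_mul_yukawa hhc hhi hH hm)

/-- **Fourier transform of the CLY kernel** [ConlonLiebYau1988, Lemma 2.1 (proof)]: for `h`
continuous, integrable and even with `𝓕h ∈ L¹`, and `m, n > 0`,
`𝓕(Y_n - hY_m)(p) = 4π/(4π²|p|²+n) - ∫ Re𝓕h(q) · 4π/(4π²|p-q|²+m) dq` (a real number).
[cite: ConlonLiebYau1988, Lemma 2.1] -/
theorem fourier_clyKernel {h : Space → ℝ} (hhc : Continuous h) (hhi : Integrable h)
    (hH : Integrable (𝓕 (fun x : Space => (h x : ℂ)))) (heven : ∀ x, h (-x) = h x) {m n : ℝ}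
    (hm : 0 < m) (hn : 0 < n) (p : Space) :
    𝓕 (fun x : Space => ((Real.exp (-(Real.sqrt n * ‖x‖)) / ‖x‖ -
        h x * (Real.exp (-(Real.sqrt m * ‖x‖)) / ‖x‖) : ℝ) : ℂ)) p =
      ((4 * π / (4 * π ^ 2 * ‖p‖ ^ 2 + n) -
        ∫ q, (𝓕 (fun x : Space => (h x : ℂ)) q).re * (4 * π / (4 * π ^ 2 * ‖p - q‖ ^ 2 + m)) : ℝ) : ℂ) := by
  have h1 := fourierIntegral_yukawa' hn p
  have h2 := fourier_smearedYukawa_re hhc hhi hH heven hm p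
  rw [Real.fourier_eq] at h1 h2 ⊢
  have hI1 : Integrable fun v : Space => 𝐞 (-⟪v, p⟫_ℝ) •
      ((Real.exp (-(Real.sqrt n * ‖v‖)) / ‖v‖ : ℝ) : ℂ) :=
    (Real.fourierIntegral_convergent_iff p).2 (integrable_yukawa hn).ofReal
  have hI2 : Integrable fun v : Space => 𝐞 (-⟪v, p⟫_ℝ) •
      ((h v * (Real.exp (-(Real.sqrt m * ‖v‖)) / ‖v‖) : ℝ) : ℂ) :=
    (Real.fourierIntegral_convergent_iff p).2 (integrable_mul_yukawa hhc hhi hH hm).ofReal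
  have e : ∀ v : Space, 𝐞 (-⟪v, p⟫_ℝ) • ((Real.exp (-(Real.sqrt n * ‖v‖)) / ‖v‖ -
      h v * (Real.exp (-(Real.sqrt m * ‖v‖)) / ‖v‖) : ℝ) : ℂ) =
      𝐞 (-⟪v, p⟫_ℝ) • ((Real.exp (-(Real.sqrt n * ‖v‖)) / ‖v‖ : ℝ) : ℂ) -
        𝐞 (-⟪v, p⟫_ℝ) • ((h v * (Real.exp (-(Real.sqrt m * ‖v‖)) / ‖v‖) : ℝ) : ℂ) := by
    intro v
    rw [← smul_sub]
    push_cast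
    ring_nf
  simp_rw [e]
  rw [integral_sub hI1 hI2, h1, h2]
  push_cast
  ring

/-- The CLY Fourier side `Φ_n` is continuous (it is `Re 𝓕K_n`, `K_n ∈ L¹`). [folklore] -/
theorem continuous_clyPhi {h : Space → ℝ} (hhc : Continuous h) (hhi : Integrable h)
    (hH : Integrable (𝓕 (fun x : Space => (h x : ℂ)))) (heven : ∀ x, h (-x) = h x) {m n : ℝ}
    (hm : 0 < m) (hn : 0 < n) :
    Continuous fun p : Space => 4 * π / (4 * π ^ 2 * ‖p‖ ^ 2 + n) -
      ∫ q, (𝓕 (fun x : Space => (h x : ℂ)) q).re * (4 * π / (4 * π ^ 2 * ‖p - q‖ ^ 2 + m)) := by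
  have hK := integrable_clyKernel hhc hhi hH hm hn
  have hc : Continuous fun p : Space => (𝓕 (fun x : Space => ((Real.exp (-(Real.sqrt n * ‖x‖)) / ‖x‖ -
      h x * (Real.exp (-(Real.sqrt m * ‖x‖)) / ‖x‖) : ℝ) : ℂ)) p).re :=
    Complex.continuous_re.comp (VectorFourier.fourierIntegral_continuous Real.continuous_fourierChar
      (innerSL ℝ).continuous₂ hK.ofReal)
  refine hc.congr fun p => ?_
  simp only [fourier_clyKernel hhc hhi hH heven hm hn p, Complex.ofReal_re]

/-- **Nonnegativity of `𝓕K_n`** [ConlonLiebYau1988, Lemma 2.1]: with `η = Re𝓕h`,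
`A = ∫(6|q|²+4π²|q|⁴)|η|`, `B = ∫(6|q|²+4π²|q|⁴)(1+4|q|²)²|η|`, if `h` is even, continuous,
integrable, `h(0) = 1`, `𝓕h ∈ L¹` with `(1+|q|²)⁴η ∈ L¹`, `m ≥ 4π²`, `m - n ≥ 32π²A`,
`m - n ≥ 16π²B` and `n > 0`, then `Φ_n(p) ≥ 0` for all `p`. [cite: ConlonLiebYau1988, Lemma 2.1] -/
theorem clyPhi_nonneg {h : Space → ℝ} (hhc : Continuous h) (hhi : Integrable h)
    (hH : Integrable (𝓕 (fun x : Space => (h x : ℂ)))) (heven : ∀ x, h (-x) = h x) (hh0 : h 0 = 1)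
    (hmom : Integrable fun q : Space => (1 + ‖q‖ ^ 2) ^ 4 * (𝓕 (fun x : Space => (h x : ℂ)) q).re)
    {m n : ℝ} (hm : 4 * π ^ 2 ≤ m) (hn : 0 < n)
    (hA : 32 * π ^ 2 * ∫ q, (6 * ‖q‖ ^ 2 + 4 * π ^ 2 * ‖q‖ ^ 4) *
      |(𝓕 (fun x : Space => (h x : ℂ)) q).re| ≤ m - n)
    (hB : 16 * π ^ 2 * ∫ q, (6 * ‖q‖ ^ 2 + 4 * π ^ 2 * ‖q‖ ^ 4) * (1 + 4 * ‖q‖ ^ 2) ^ 2 *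
      |(𝓕 (fun x : Space => (h x : ℂ)) q).re| ≤ m - n) (p : Space) :
    0 ≤ 4 * π / (4 * π ^ 2 * ‖p‖ ^ 2 + n) -
      ∫ q, (𝓕 (fun x : Space => (h x : ℂ)) q).re * (4 * π / (4 * π ^ 2 * ‖p - q‖ ^ 2 + m)) := by
  have h := cly_fourier_positivity (continuous_re_fourier_ofReal hhi).measurable
    (fun q => re_fourier_ofReal_neg h q) (integral_re_fourier_eq_one hhc hhi hH heven hh0) hmom hm
    hA hB p (by positivity)
  linarith

/-- **An integrable majorant for `Φ_n`**: under the hypotheses of `clyPhi_nonneg` but only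
`m ≥ 1`, `n ≤ m`, for all `p` with `4π²|p|² + n > 0`,
`|Φ_n(p)| ≤ (4π/(4π²|p|²+n) - 4π/(4π²|p|²+m)) + 64π³A/(4π²|p|²+m)² + 16π³B/(m²(1+|p|²)²)`.
[cite: ConlonLiebYau1988, Lemma 2.1 (proof)] -/
theorem abs_clyPhi_le {h : Space → ℝ} (hhc : Continuous h) (hhi : Integrable h)
    (hH : Integrable (𝓕 (fun x : Space => (h x : ℂ)))) (heven : ∀ x, h (-x) = h x) (hh0 : h 0 = 1)
    (hmom : Integrable fun q : Space => (1 + ‖q‖ ^ 2) ^ 4 * (𝓕 (fun x : Space => (h x : ℂ)) q).re)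
    {m n : ℝ} (hm1 : 1 ≤ m) (hnm : n ≤ m) (p : Space) (hp : 0 < 4 * π ^ 2 * ‖p‖ ^ 2 + n) :
    |4 * π / (4 * π ^ 2 * ‖p‖ ^ 2 + n) -
        ∫ q, (𝓕 (fun x : Space => (h x : ℂ)) q).re * (4 * π / (4 * π ^ 2 * ‖p - q‖ ^ 2 + m))| ≤
      (4 * π / (4 * π ^ 2 * ‖p‖ ^ 2 + n) - 4 * π / (4 * π ^ 2 * ‖p‖ ^ 2 + m)) +
        (64 * π ^ 3 * (∫ q, (6 * ‖q‖ ^ 2 + 4 * π ^ 2 * ‖q‖ ^ 4) *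
            |(𝓕 (fun x : Space => (h x : ℂ)) q).re|) * (1 / (4 * π ^ 2 * ‖p‖ ^ 2 + m) ^ 2) +
          16 * π ^ 3 * (∫ q, (6 * ‖q‖ ^ 2 + 4 * π ^ 2 * ‖q‖ ^ 4) * (1 + 4 * ‖q‖ ^ 2) ^ 2 *
            |(𝓕 (fun x : Space => (h x : ℂ)) q).re|) / m ^ 2 * (1 / (1 + ‖p‖ ^ 2) ^ 2)) := by
  have hm0 : 0 < m := by linarith
  have hπ : 0 < π := Real.pi_pos
  obtain ⟨hdec, hrem⟩ := cly_taylor_decomposition (continuous_re_fourier_ofReal hhi).measurable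
    (fun q => re_fourier_ofReal_neg h q) (integral_re_fourier_eq_one hhc hhi hH heven hh0) hmom hm1 p
  set A := ∫ q, (6 * ‖q‖ ^ 2 + 4 * π ^ 2 * ‖q‖ ^ 4) * |(𝓕 (fun x : Space => (h x : ℂ)) q).re|
    with hAdef
  set B := ∫ q, (6 * ‖q‖ ^ 2 + 4 * π ^ 2 * ‖q‖ ^ 4) * (1 + 4 * ‖q‖ ^ 2) ^ 2 *
    |(𝓕 (fun x : Space => (h x : ℂ)) q).re| with hBdef
  have hAnn : 0 ≤ A := integral_nonneg fun q => by positivity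
  have hBnn : 0 ≤ B := integral_nonneg fun q => by positivity
  have hC : 0 < 4 * π ^ 2 * ‖p‖ ^ 2 + m := by positivity
  -- the signed decomposition: `Φ_n = (ŷ_n - ŷ_m) - ∫ Rem η`
  rw [hdec]
  have hsub0 : 0 ≤ 4 * π / (4 * π ^ 2 * ‖p‖ ^ 2 + n) - 4 * π / (4 * π ^ 2 * ‖p‖ ^ 2 + m) :=
    sub_nonneg.2 (div_le_div_of_nonneg_left (by positivity) hp (by linarith))
  have hW : (1 / ((4 * π ^ 2 * ‖p‖ ^ 2 + m) * m * (1 + ‖p‖ ^ 2) ^ 2)) ≤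
      1 / m ^ 2 * (1 / (1 + ‖p‖ ^ 2) ^ 2) := by
    rw [show 1 / m ^ 2 * (1 / (1 + ‖p‖ ^ 2) ^ 2) = 1 / (m * m * (1 + ‖p‖ ^ 2) ^ 2) by
      field_simp]
    refine one_div_le_one_div_of_le (by positivity) ?_
    have : m ≤ 4 * π ^ 2 * ‖p‖ ^ 2 + m := by nlinarith [sq_nonneg (π * ‖p‖)]
    exact mul_le_mul_of_nonneg_right (mul_le_mul_of_nonneg_right this hm0.le) (by positivity)
  have key : 4 * π / (4 * π ^ 2 * ‖p‖ ^ 2 + n) - (4 * π / (4 * π ^ 2 * ‖p‖ ^ 2 + m) +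
      ∫ q, (4 * π / (4 * π ^ 2 * ‖p - q‖ ^ 2 + m) - 4 * π / (4 * π ^ 2 * ‖p‖ ^ 2 + m) -
        32 * π ^ 3 * ⟪p, q⟫_ℝ / (4 * π ^ 2 * ‖p‖ ^ 2 + m) ^ 2) * (𝓕 (fun x : Space => (h x : ℂ)) q).re) =
      (4 * π / (4 * π ^ 2 * ‖p‖ ^ 2 + n) - 4 * π / (4 * π ^ 2 * ‖p‖ ^ 2 + m)) -
        ∫ q, (4 * π / (4 * π ^ 2 * ‖p - q‖ ^ 2 + m) - 4 * π / (4 * π ^ 2 * ‖p‖ ^ 2 + m) -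
          32 * π ^ 3 * ⟪p, q⟫_ℝ / (4 * π ^ 2 * ‖p‖ ^ 2 + m) ^ 2) * (𝓕 (fun x : Space => (h x : ℂ)) q).re := by
    ring
  rw [key]
  refine (abs_sub _ _).trans ?_
  rw [abs_of_nonneg hsub0]
  refine add_le_add le_rfl (hrem.trans (add_le_add (le_of_eq (by ring)) ?_))
  calc 16 * π ^ 3 / ((4 * π ^ 2 * ‖p‖ ^ 2 + m) * m * (1 + ‖p‖ ^ 2) ^ 2) * B
      = 16 * π ^ 3 * B * (1 / ((4 * π ^ 2 * ‖p‖ ^ 2 + m) * m * (1 + ‖p‖ ^ 2) ^ 2)) := by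
        ring
    _ ≤ 16 * π ^ 3 * B * (1 / m ^ 2 * (1 / (1 + ‖p‖ ^ 2) ^ 2)) :=
        mul_le_mul_of_nonneg_left hW (by positivity)
    _ = 16 * π ^ 3 * B / m ^ 2 * (1 / (1 + ‖p‖ ^ 2) ^ 2) := by ring

/-- **`Φ_n` is integrable** (`n > 0`, `1 ≤ m`, `n ≤ m`, moments of `Re𝓕h`): it is continuous and
dominated by the integrable majorant of `abs_clyPhi_le`. [cite: ConlonLiebYau1988, Lemma 2.1] -/
theorem integrable_clyPhi {h : Space → ℝ} (hhc : Continuous h) (hhi : Integrable h)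
    (hH : Integrable (𝓕 (fun x : Space => (h x : ℂ)))) (heven : ∀ x, h (-x) = h x) (hh0 : h 0 = 1)
    (hmom : Integrable fun q : Space => (1 + ‖q‖ ^ 2) ^ 4 * (𝓕 (fun x : Space => (h x : ℂ)) q).re)
    {m n : ℝ} (hm1 : 1 ≤ m) (hn : 0 < n) (hnm : n ≤ m) :
    Integrable fun p : Space => 4 * π / (4 * π ^ 2 * ‖p‖ ^ 2 + n) -
      ∫ q, (𝓕 (fun x : Space => (h x : ℂ)) q).re * (4 * π / (4 * π ^ 2 * ‖p - q‖ ^ 2 + m)) := by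
  have hm0 : 0 < m := by linarith
  have hπ : 0 < π := Real.pi_pos
  have hG : Integrable fun p : Space =>
      (4 * π / (4 * π ^ 2 * ‖p‖ ^ 2 + n) - 4 * π / (4 * π ^ 2 * ‖p‖ ^ 2 + m)) +
        (64 * π ^ 3 * (∫ q, (6 * ‖q‖ ^ 2 + 4 * π ^ 2 * ‖q‖ ^ 4) *
            |(𝓕 (fun x : Space => (h x : ℂ)) q).re|) * (1 / (4 * π ^ 2 * ‖p‖ ^ 2 + m) ^ 2) +
          16 * π ^ 3 * (∫ q, (6 * ‖q‖ ^ 2 + 4 * π ^ 2 * ‖q‖ ^ 4) * (1 + 4 * ‖q‖ ^ 2) ^ 2 *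
            |(𝓕 (fun x : Space => (h x : ℂ)) q).re|) / m ^ 2 * (1 / (1 + ‖p‖ ^ 2) ^ 2)) :=
    (integrable_yukawaSymbol_sub hn.le hnm hm0).add
      (((integrable_inv_quadratic_sq hm0 (by positivity : (0:ℝ) < 4 * π ^ 2)).const_mul _).add
        (integrable_inv_one_add_normSq_sq.const_mul _))
  refine hG.mono' (continuous_clyPhi hhc hhi hH heven hm0 hn).aestronglyMeasurable
    (Eventually.of_forall fun p => ?_)
  rw [Real.norm_eq_abs]
  exact abs_clyPhi_le hhc hhi hH heven hh0 hmom hm1 hnm p (by positivity)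

/-- The CLY kernel is even. [folklore] -/
theorem clyKernel_even {h : Space → ℝ} (heven : ∀ x, h (-x) = h x) (m n : ℝ) (x : Space) :
    Real.exp (-(Real.sqrt n * ‖-x‖)) / ‖-x‖ - h (-x) * (Real.exp (-(Real.sqrt m * ‖-x‖)) / ‖-x‖) =
      Real.exp (-(Real.sqrt n * ‖x‖)) / ‖x‖ - h x * (Real.exp (-(Real.sqrt m * ‖x‖)) / ‖x‖) := by
  rw [norm_neg, heven]

/-- The CLY kernel is continuous away from the origin. [folklore] -/
theorem continuousAt_clyKernel {h : Space → ℝ} (hhc : Continuous h) (m n : ℝ) {z : Space}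
    (hz : z ≠ 0) : ContinuousAt (fun x : Space => Real.exp (-(Real.sqrt n * ‖x‖)) / ‖x‖ -
      h x * (Real.exp (-(Real.sqrt m * ‖x‖)) / ‖x‖)) z := by
  have hz' : ‖z‖ ≠ 0 := norm_ne_zero_iff.2 hz
  have hY : ∀ a : ℝ, ContinuousAt (fun x : Space => Real.exp (-(a * ‖x‖)) / ‖x‖) z := fun a =>
    ((Real.continuous_exp.comp (continuous_const.mul continuous_norm).neg).continuousAt).div
      continuous_norm.continuousAt hz'
  exact (hY _).sub (hhc.continuousAt.mul (hY _))

/-- **The CLY kernel as a cosine integral of its nonnegative Fourier transform**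
[ConlonLiebYau1988, Lemma 2.1; LiebSolovej2001, Lemma 3.1 (proof)]: under the hypotheses of
`integrable_clyPhi`, for every `z ≠ 0`,
`e^{-√n|z|}/|z| - h(z)e^{-√m|z|}/|z| = ∫ Φ_n(p) cos(2π⟨p, z⟩) dp`.
[cite: ConlonLiebYau1988, Lemma 2.1] -/
theorem clyKernel_eq_integral_clyPhi_cos {h : Space → ℝ} (hhc : Continuous h) (hhi : Integrable h)
    (hH : Integrable (𝓕 (fun x : Space => (h x : ℂ)))) (heven : ∀ x, h (-x) = h x) (hh0 : h 0 = 1)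
    (hmom : Integrable fun q : Space => (1 + ‖q‖ ^ 2) ^ 4 * (𝓕 (fun x : Space => (h x : ℂ)) q).re)
    {m n : ℝ} (hm1 : 1 ≤ m) (hn : 0 < n) (hnm : n ≤ m) {z : Space} (hz : z ≠ 0) :
    Real.exp (-(Real.sqrt n * ‖z‖)) / ‖z‖ - h z * (Real.exp (-(Real.sqrt m * ‖z‖)) / ‖z‖) =
      ∫ p, (4 * π / (4 * π ^ 2 * ‖p‖ ^ 2 + n) -
        ∫ q, (𝓕 (fun x : Space => (h x : ℂ)) q).re * (4 * π / (4 * π ^ 2 * ‖p - q‖ ^ 2 + m))) *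
          Real.cos (2 * π * ⟪p, z⟫_ℝ) := by
  have hm0 : 0 < m := by linarith
  have hK := integrable_clyKernel hhc hhi hH hm0 hn
  have hF : 𝓕 (fun x : Space => ((Real.exp (-(Real.sqrt n * ‖x‖)) / ‖x‖ -
      h x * (Real.exp (-(Real.sqrt m * ‖x‖)) / ‖x‖) : ℝ) : ℂ)) = fun p : Space =>
      ((4 * π / (4 * π ^ 2 * ‖p‖ ^ 2 + n) -
        ∫ q, (𝓕 (fun x : Space => (h x : ℂ)) q).re * (4 * π / (4 * π ^ 2 * ‖p - q‖ ^ 2 + m)) : ℝ) : ℂ) :=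
    funext fun p => fourier_clyKernel hhc hhi hH heven hm0 hn p
  have hFi : Integrable (𝓕 (fun x : Space => ((Real.exp (-(Real.sqrt n * ‖x‖)) / ‖x‖ -
      h x * (Real.exp (-(Real.sqrt m * ‖x‖)) / ‖x‖) : ℝ) : ℂ))) := by
    rw [hF]
    exact (integrable_clyPhi hhc hhi hH heven hh0 hmom hm1 hn hnm).ofReal
  have hrep := eq_integral_re_fourier_mul_cos_of_continuousAt hK hFi
    (fun x => clyKernel_even heven m n x) (continuousAt_clyKernel hhc m n hz)
  rw [hrep]
  refine integral_congr_ae (Eventually.of_forall fun p => ?_)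
  rw [hF]
  simp only [Complex.ofReal_re]

end Literature.MathematicalPhysics.QuantumManyBody.Coulomb
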